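/-
Origin: expansion seat `planner-pub-hodgecm-pv11-g9-0`, handover none (imports the tree module HodgeCM.Automorphic.SignRecipeEndState only) ; after HodgeCM/Automorphic/SignRecipeEndState.lean (prl1-g5, landed r27); NEW additive leaf; BEFORE my row 2 (`HOME/pub-hodgecm-pv11-g9/lean/Pv11g9/EndStateInvariance.lean`, md5 46974218, 243 lines);
landed by the gen-8 packager in gate run 29 as `HodgeCM/Automorphic/EndStateInvariance.lean` (verbatim).
-/
/-
Copyright: pub-hodgecm cell, unit pub-hodgecm-pv11-g9 (DAG-NODE PROVER #11, gen 9), node #2. Mathlib + tree only.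
Origin / target: `HOME/pub-hodgecm-pv11-g9/lean/Pv11g9/EndStateInvariance.lean` → `HodgeCM/Automorphic/EndStateInvariance.lean`
(imports the TREE module `HodgeCM.Automorphic.SignRecipeEndState` (prl1-g5, RUN 27) only; no rewrite).
-/
import Summits.HodgeConjecture.HodgeCM.Automorphic.SignRecipeEndState

/-!
# N21 on the END STATE: `𝒯_{ω(h)Φ}(R(h)v) = 𝒯_Φ(v)` is a kernel theorem of the Weil theta model;
# so are the S4 continuity `Φ ↦ 𝒯_Φ(v)(g)` and the evaluation points of `[G_U]`

PerL v5 (tex blob d912a121, LEMMAS.md §0), node N21, verbatim ll. 380–383: "For $\Phi\in\cS$ let $\mathcal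
T_\Phi\colon L^2([\U(W)])\to L^2([G_U])$, $(\mathcal T_\Phi v)(g):=\int_{[\U(W)]}\theta_\Phi(g,h) v(h)\,dh$. As
$\theta_\Phi$ is continuous on the compact space $[G_U]\times[\U(W)]$, $\mathcal T_\Phi$ is Hilbert--Schmidt, hence
bounded; and $\mathcal T_{\omega(h_0)\Phi}(R(h_0)v)=\mathcal T_\Phi(v)$ for $h_0\in\U(W)(\A)$, $R$ the right regular
representation."  First sentence: LANDED as pv05's `KernelOperator.opTC` (run 19) and built into every kernel-model
core (`KernelCoreCarrier.toRegCoreCarrier`, pv15-g2).  Second sentence: proved over an ABSTRACT core through an explicit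
dictionary by pv12-g3 (`ArchC.KernelDictionary.invariance`, run 23), and carried as the field `invariance` `[NODE N21]`
of the S4 records `ArchC.ArchCDatum` / `FockAnalyticBridge` / `PrintedAnalyticSide` (pv06, pv12-g4, pv12-g7).
Lemma 4.1(c) proof, ll. 518–520 (verbatim): "it is continuous for the $L^2$-norm ($\mathcal T_\Phi$ is
Hilbert--Schmidt and its image consists of continuous functions depending continuously on $v$ in the uniform norm)"
and l. 514 "non-zero on $\cS^\kappa\times\hat\sigma$ for some $g$" — carried as the S4 field `cont` `[SETUP D4]`
(`Φ ↦ 𝒯_Φ(v)(g)` continuous on `𝒮^κ`) and as the Hahn–Banach point datum `P : C4a.PointedCore` (Prior, M1).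

ON THE END STATE all three are THEOREMS / CANONICAL, with no dictionary: prl1-g4/g5's end-state theta model
`T∘ := ThetaModel.ofRegCarrier (C.rtc R12 R34) hA` (`C : U.AdelicTorusCore hP`; in particular prl1-g5's
`C₀.thetaModel h d12 d34`) has, DEFINITIONALLY (`rfl` through `ofRegCarrier / ofRepCarrier / ofCarrier /
toIsolationCore / KernelModel.core`),
  `(T∘.core V c).TΦc Φ = KernelOperator.opTC ((C.wm V c).θ Φ) ν_{[U(W)]}`,
  `(T∘.core V c).R = QuotientSmoothing.ρ ν_{[U(W)]}` (`(ρ(h)v)(x) = v(h⁻¹ • x)`),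
  `(T∘.core V c).omg = (C.wm V c).omg`, `C([G_U]) = C(G_U ⧸ Γ_U, ℂ)`,
and pv14/prl1-g4's `WeilThetaModel` carries the STRUCTURAL LAWS `θ_omg : θ_{ω(h)Φ}(ξ, q) = θ_Φ(ξ, h⁻¹ • q)` (tex
l. 414) and `θ_cont : Continuous (Φ ↦ θ_Φ)` as THEOREMS of [We64] n° 37–41 (`WeilThetaModel.structural_laws`).  Hence:

* §1 (any kernel model over two quotient models, `KernelModel.core QU Q SK omg θ`): `KernelModel.opTC_omg_ρ` — N21's
  second sentence from `θ_omg`, by the change of variables `q ↦ h⁻¹ • q` in `∫_{[U(W)]}` (`ν` is `U(W)(𝔸)`-invariant: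
  `QuotientSmoothing.measurePreserving_act`); `KernelModel.continuous_opTC_apply` — `Φ ↦ (𝒯_{θ_Φ} v)(ξ)` is continuous
  from `θ_cont` and pv05's `KernelOperator.continuous_kernel_to_fun` (‖𝒯_k v‖_∞ ≤ ν^{1/2} ‖k‖_∞ ‖v‖₂).
* §2 (the END STATE `T∘`): `AdelicTorusCore.TΦc_omg_R` — **N21 `invariance` in the exact S4 field shape**
  `(T∘.core V c).TΦc ((T∘.core V c).omg h Φ) ((T∘.core V c).R h v) = (T∘.core V c).TΦc Φ v`; the CANONICAL point datum
  `AdelicTorusCore.pointedCore : C4a.PointedCore (T∘.core V c)` (`Pt := G_U ⧸ Γ_U`, `evalPt ξ := evalCLM ξ`, separation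
  `:= ContinuousMap.ext`); and `AdelicTorusCore.continuous_evalPt_TΦc` — **the S4 field `cont` at the canonical points**
  (and `continuous_dual_TΦc` — at the Hahn–Banach points `PointedCore.ofDual` = `T∘.pointedCores V c` of pv08-g3's
  `S4Strength`, the `Pc` at which pv01-g4's `EndStateCensus` reads the S4 records).
* §3 the same three for prl1-g5's `C₀.thetaModel h d12 d34` (`rfl`-specialisation).

Consequence for the ledger of open inputs: of pv12-g7's 24-field S4 record `PrintedAnalyticSide` on the end state, the
torus fields (`ιT`, `wOccurs_of_eigenvector`: pv11-g8 / this seat's `PrintedTorusEndState`), the N21 field `invariance`,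
the continuity field `cont` AND the point datum `P` are no longer inputs; `PrintedTorusEndState` (this seat, node #1)
packages the remaining TWENTY fields as `ArchC.ModelAnalyticSide`.  Nothing cited, nothing posited; no statement of
PerL / QW8 / the 2001 programme is a hypothesis.
-/

set_option autoImplicit false

noncomputable section

open MeasureTheory

attribute [-instance] Quotient.instMeasurableSpace

namespace HodgeCM

/-! ## §1  N21 and the kernel-continuity on any kernel model over quotient models -/

namespace KernelModel

open HodgeCM.PerL34 HodgeCM.PerL34.KernelOperator HodgeCM.PerL34.QuotientSmoothing

variable (QU Q : QuotientModel) {SK : Type} [TopologicalSpace SK] (omg : Q.G → SK → SK)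
    (θ : SK → C((QU.G ⧸ QU.Γ) × (Q.G ⧸ Q.Γ), ℂ))

omit [TopologicalSpace SK] in
/-- **N21, second sentence (tex ll. 382–383), on a kernel model (KERNEL)**: if the kernels are Weil-equivariant,
`θ_{ω(h)Φ}(ξ, q) = θ_Φ(ξ, h⁻¹ • q)` (tex l. 414; `WeilThetaModel.θ_omg`), then
`𝒯_{θ_{ω(h)Φ}}(ρ(h) v) = 𝒯_{θ_Φ}(v)` for the regular representation `(ρ(h)v)(x) = v(h⁻¹ • x)` on `L²([U(W)], ν)` —
the change of variables `q ↦ h⁻¹ • q` under the invariant measure `ν`. -/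
theorem opTC_omg_ρ
    (hθ : ∀ (h : Q.G) (Φ : SK) (ξ : QU.G ⧸ QU.Γ) (q : Q.G ⧸ Q.Γ), θ (omg h Φ) (ξ, q) = θ Φ (ξ, h⁻¹ • q))
    (h : Q.G) (Φ : SK) (v : Lp ℂ 2 Q.ν) :
    opTC (θ (omg h Φ)) Q.ν (ρ Q.ν h v) = opTC (θ Φ) Q.ν v := by
  ext ξ
  simp only [opTC_apply, evalT_eq_integral]
  have hv : ((ρ Q.ν h v : Lp ℂ 2 Q.ν) : Q.G ⧸ Q.Γ → ℂ) =ᵐ[Q.ν] fun q => v (h⁻¹ • q) := coeFn_ρ Q.ν h v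
  calc ∫ q, θ (omg h Φ) (ξ, q) * (ρ Q.ν h v : Lp ℂ 2 Q.ν) q ∂Q.ν
      = ∫ q, θ Φ (ξ, (act h : Q.G ⧸ Q.Γ → Q.G ⧸ Q.Γ) q) * v ((act h : Q.G ⧸ Q.Γ → Q.G ⧸ Q.Γ) q) ∂Q.ν := by
        apply integral_congr_ae
        filter_upwards [hv] with q hq
        rw [hq, hθ, act_apply]
    _ = ∫ q, θ Φ (ξ, q) * v q ∂Q.ν :=
        (measurePreserving_act Q.ν h).integral_comp (Homeomorph.smul h⁻¹).measurableEmbedding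
          (fun q => θ Φ (ξ, q) * v q)

/-- **The S4 continuity on a kernel model (KERNEL)**: if `Φ ↦ θ_Φ` is continuous into `C([G_U] × [U(W)], ℂ)`
(`WeilThetaModel.θ_cont`), then for every `v ∈ L²([U(W)])` and every point `ξ ∈ [G_U]` the scalar
`Φ ↦ (𝒯_{θ_Φ} v)(ξ)` is continuous (pv05 `continuous_kernel_to_fun`: `k ↦ 𝒯_k v` is sup-norm bounded). -/
theorem continuous_opTC_apply (hθc : Continuous θ) (v : Lp ℂ 2 Q.ν) (ξ : QU.G ⧸ QU.Γ) :
    Continuous fun Φ : SK => opTC (θ Φ) Q.ν v ξ :=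
  ((continuous_eval_const ξ).comp (continuous_kernel_to_fun Q.ν v)).comp hθc

/-- The same with values in `C([G_U])` (sup norm): `Φ ↦ 𝒯_{θ_Φ} v` is continuous. -/
theorem continuous_opTC (hθc : Continuous θ) (v : Lp ℂ 2 Q.ν) :
    Continuous fun Φ : SK => opTC (θ Φ) Q.ν v :=
  (continuous_kernel_to_fun Q.ν v).comp hθc

end KernelModel

/-! ## §2  On the END STATE `ThetaModel.ofRegCarrier (C.rtc R12 R34) hA` -/

namespace Universe
namespace AdelicTorusCore

open HodgeCM.PerL34
open HodgeCM.Prior.Perl34File HodgeCM.Prior.Perl34File.Perl34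

variable {U : Universe} {hP : PrintFact_unitaryCompact} (C : U.AdelicTorusCore hP)
  (R12 : ∀ {L : CMField} {ι₁ : L →+* ℂ} (V : HermSpace3 L ι₁) (c : SeesawCtx L), C.Rest12 V c)
  (R34 : ∀ {L : CMField} {ι₁ : L →+* ℂ} (V : HermSpace3 L ι₁) (c : SeesawCtx L), C.Rest34 V c)
  (hA : (C.rtc R12 R34).Analytic)
  {L : CMField} {ι₁ : L →+* ℂ} (V : HermSpace3 L ι₁) (c : SeesawCtx L)

/-- Dictionary (`rfl`): `𝒯_Φ = opTC (θ_Φ) ν`. -/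
theorem core_TΦc_eq (Φ : (ThetaModel.ofRegCarrier (C.rtc R12 R34) hA).SK V c) :
    ((ThetaModel.ofRegCarrier (C.rtc R12 R34) hA).core V c).TΦc Φ =
      KernelOperator.opTC ((C.wm V c).θ Φ) (c.D.latticeModelW hP).toQuotientModel.ν := rfl

/-- Dictionary (`rfl`): `R = ρ ν`, the regular representation of `U(W)(𝔸)` on `L²([U(W)])`. -/
theorem core_R_eq (h : (ThetaModel.ofRegCarrier (C.rtc R12 R34) hA).G V c) :
    ((ThetaModel.ofRegCarrier (C.rtc R12 R34) hA).core V c).R h =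
      QuotientSmoothing.ρ (c.D.latticeModelW hP).toQuotientModel.ν h := rfl

/-- Dictionary (`rfl`): `ω = ` the Weil theta model's `omg`. -/
theorem core_omg_eq (h : (ThetaModel.ofRegCarrier (C.rtc R12 R34) hA).G V c)
    (Φ : (ThetaModel.ofRegCarrier (C.rtc R12 R34) hA).SK V c) :
    ((ThetaModel.ofRegCarrier (C.rtc R12 R34) hA).core V c).omg h Φ = (C.wm V c).omg h Φ := rfl

/-- **N21 `invariance` on the END STATE (KERNEL), in the exact shape of the S4 field**
(`ArchCDatum.invariance` / `FockAnalyticBridge.invariance` / `PrintedAnalyticSide.invariance`):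
`𝒯_{ω(h)Φ}(R(h)v) = 𝒯_Φ(v)` — from the Weil theta model's structural law `θ_omg` by §1. -/
theorem TΦc_omg_R (h : (ThetaModel.ofRegCarrier (C.rtc R12 R34) hA).G V c)
    (Φ : (ThetaModel.ofRegCarrier (C.rtc R12 R34) hA).SK V c) (v : (ThetaModel.ofRegCarrier (C.rtc R12 R34) hA).H V c) :
    ((ThetaModel.ofRegCarrier (C.rtc R12 R34) hA).core V c).TΦc
        (((ThetaModel.ofRegCarrier (C.rtc R12 R34) hA).core V c).omg h Φ)
        (((ThetaModel.ofRegCarrier (C.rtc R12 R34) hA).core V c).R h v) =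
      ((ThetaModel.ofRegCarrier (C.rtc R12 R34) hA).core V c).TΦc Φ v :=
  KernelModel.opTC_omg_ρ (V.latticeModel hP).toQuotientModel (c.D.latticeModelW hP).toQuotientModel
    (C.wm V c).omg (C.wm V c).θ (C.wm V c).θ_omg h Φ v

/-- N21 on the END STATE, all arguments quantified (the literal type of the S4 field `invariance`). -/
theorem invariance :
    ∀ (h : (ThetaModel.ofRegCarrier (C.rtc R12 R34) hA).G V c)
      (Φ : (ThetaModel.ofRegCarrier (C.rtc R12 R34) hA).SK V c) (v : (ThetaModel.ofRegCarrier (C.rtc R12 R34) hA).H V c),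
      ((ThetaModel.ofRegCarrier (C.rtc R12 R34) hA).core V c).TΦc
          (((ThetaModel.ofRegCarrier (C.rtc R12 R34) hA).core V c).omg h Φ)
          (((ThetaModel.ofRegCarrier (C.rtc R12 R34) hA).core V c).R h v) =
        ((ThetaModel.ofRegCarrier (C.rtc R12 R34) hA).core V c).TΦc Φ v :=
  C.TΦc_omg_R R12 R34 hA V c

/-- **The CANONICAL point datum of the END STATE** (Prior's M1 `C4a.PointedCore`, "for some g", l. 514): the
points of `[G_U] = G_U ⧸ Γ_U` themselves, evaluation `evalCLM`, separation = extensionality of `C([G_U], ℂ)`.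
(pv08-g3's `ArchC.PointedCore.ofDual` / `nonempty_pointedCore` (`S4Strength`) give SOME point datum on any core — the
whole dual; this is the INTENDED instance named there, available because the end state's `C([G_U])` is literally
`C(G_U ⧸ Γ_U, ℂ)`.) -/
def pointedCore : C4a.PointedCore ((ThetaModel.ofRegCarrier (C.rtc R12 R34) hA).core V c) where
  Pt := (V.latticeModel hP).toQuotientModel.G ⧸ (V.latticeModel hP).toQuotientModel.Γ
  evalPt := fun ξ => ContinuousMap.evalCLM ℂ ξ
  evalPt_sep := fun _ hφ => ContinuousMap.ext fun ξ => hφ ξ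

/-- Its evaluation functionals are the point evaluations of `C([G_U], ℂ)` (`rfl`). -/
theorem pointedCore_evalPt (ξ : (C.pointedCore R12 R34 hA V c).Pt)
    (φ : C((V.latticeModel hP).toQuotientModel.G ⧸ (V.latticeModel hP).toQuotientModel.Γ, ℂ)) :
    (C.pointedCore R12 R34 hA V c).evalPt ξ φ = φ ξ := rfl

/-- **The S4 field `cont` on the END STATE at the canonical points (KERNEL)**: `Φ ↦ 𝒯_Φ(v)(ξ)` is continuous on
`𝒮^κ` — from the Weil theta model's structural law `θ_cont` by §1. -/
theorem continuous_evalPt_TΦc (ξ : (C.pointedCore R12 R34 hA V c).Pt)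
    (v : (ThetaModel.ofRegCarrier (C.rtc R12 R34) hA).H V c) :
    Continuous fun Φ : (ThetaModel.ofRegCarrier (C.rtc R12 R34) hA).SK V c =>
      (C.pointedCore R12 R34 hA V c).evalPt ξ (((ThetaModel.ofRegCarrier (C.rtc R12 R34) hA).core V c).TΦc Φ v) :=
  KernelModel.continuous_opTC_apply (V.latticeModel hP).toQuotientModel (c.D.latticeModelW hP).toQuotientModel
    (C.wm V c).θ (C.wm V c).θ_cont v ξ

/-- `Φ ↦ 𝒯_Φ v ∈ C([G_U])` is continuous for the sup norm (ll. 519–520 "continuous functions depending continuously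
…"; here in `Φ`). -/
theorem continuous_TΦc_apply (v : (ThetaModel.ofRegCarrier (C.rtc R12 R34) hA).H V c) :
    Continuous fun Φ : (ThetaModel.ofRegCarrier (C.rtc R12 R34) hA).SK V c =>
      ((ThetaModel.ofRegCarrier (C.rtc R12 R34) hA).core V c).TΦc Φ v :=
  KernelModel.continuous_opTC (V.latticeModel hP).toQuotientModel (c.D.latticeModelW hP).toQuotientModel
    (C.wm V c).θ (C.wm V c).θ_cont v

/-- **The S4 field `cont` on the END STATE at the HAHN–BANACH points** (pv08-g3's `ArchC.PointedCore.ofDual`: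
`Pt := C([G_U]) →L[ℂ] ℂ`, `evalPt l := l`; = `ThetaModel.pointedCores` of `S4Strength`, the `Pc` at which pv01-g4's
`EndStateCensus` reads the S4 records): for every continuous functional `l` on `C([G_U])`, `Φ ↦ l (𝒯_Φ v)` is
continuous (KERNEL) — literally the field `cont` there, by `rfl` on `evalPt`. -/
theorem continuous_dual_TΦc (l : (ThetaModel.ofRegCarrier (C.rtc R12 R34) hA).CG V c →L[ℂ] ℂ)
    (v : (ThetaModel.ofRegCarrier (C.rtc R12 R34) hA).H V c) :
    Continuous fun Φ : (ThetaModel.ofRegCarrier (C.rtc R12 R34) hA).SK V c =>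
      l (((ThetaModel.ofRegCarrier (C.rtc R12 R34) hA).core V c).TΦc Φ v) :=
  l.continuous.comp (C.continuous_TΦc_apply R12 R34 hA V c v)

end AdelicTorusCore

/-! ## §3  The same for the sign-recipe end state `C₀.thetaModel h d12 d34` (prl1-g5) -/

namespace AdelicThetaCore

open HodgeCM.PerL34
open HodgeCM.Prior.Perl34File HodgeCM.Prior.Perl34File.Perl34

variable {U : Universe} {hP : PrintFact_unitaryCompact} (C : U.AdelicThetaCore hP) (h : Bool)
  (d12 d34 : ∀ {L : CMField}, SeesawCtx L → SideData L)
  {L : CMField} {ι₁ : L →+* ℂ} (V : HermSpace3 L ι₁) (c : SeesawCtx L)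

/-- **N21 `invariance` on prl1-g5's END STATE `C.thetaModel h d12 d34` (KERNEL).** -/
theorem invariance_thetaModel :
    ∀ (g : (C.thetaModel h d12 d34).G V c) (Φ : (C.thetaModel h d12 d34).SK V c) (v : (C.thetaModel h d12 d34).H V c),
      ((C.thetaModel h d12 d34).core V c).TΦc (((C.thetaModel h d12 d34).core V c).omg g Φ)
          (((C.thetaModel h d12 d34).core V c).R g v) =
        ((C.thetaModel h d12 d34).core V c).TΦc Φ v :=
  (C.toCore h).invariance _ _ _ V c

/-- The canonical point datum of prl1-g5's END STATE. -/
abbrev pointedCore : C4a.PointedCore ((C.thetaModel h d12 d34).core V c) :=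
  (C.toCore h).pointedCore ((C.toCore h).side12 d12) ((C.toCore h).side34 d34) _ V c

/-- **The S4 field `cont` on prl1-g5's END STATE at the canonical points (KERNEL).** -/
theorem continuous_evalPt_TΦc_thetaModel (ξ : (C.pointedCore h d12 d34 V c).Pt) (v : (C.thetaModel h d12 d34).H V c) :
    Continuous fun Φ : (C.thetaModel h d12 d34).SK V c =>
      (C.pointedCore h d12 d34 V c).evalPt ξ (((C.thetaModel h d12 d34).core V c).TΦc Φ v) :=
  (C.toCore h).continuous_evalPt_TΦc _ _ _ V c ξ v

/-- **The S4 field `cont` on prl1-g5's END STATE at the Hahn–Banach points** (`PointedCore.ofDual`; KERNEL). -/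
theorem continuous_dual_TΦc_thetaModel (l : (C.thetaModel h d12 d34).CG V c →L[ℂ] ℂ)
    (v : (C.thetaModel h d12 d34).H V c) :
    Continuous fun Φ : (C.thetaModel h d12 d34).SK V c => l (((C.thetaModel h d12 d34).core V c).TΦc Φ v) :=
  (C.toCore h).continuous_dual_TΦc _ _ _ V c l v

end AdelicThetaCore

end Universe
end HodgeCM

end
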